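import Literature.AlgebraicGeometry.Resolution.EmbeddedResolutionCentre
import Literature.AlgebraicGeometry.Resolution.ResolutionGlue
import Mathlib.AlgebraicGeometry.Morphisms.Proper
import HarnessLib

/-!
# A proper morphism from a regular scheme which is an isomorphism over a dense open is a
# resolution, after discarding the components off that open

Topic: `Literature/AlgebraicGeometry/Resolution`. The weak notion of resolution of singularities
of this tree (`Scheme.HasResolution`, `ResolutionOfSingularities.lean`: a proper birational
morphism from a regular scheme, birational meaning an isomorphism over a dense open with dense
preimage) asks for density of the preimage of the open upstairs. When a candidate
`π : Z → Y` (proper, `Z` regular and locally Noetherian, an isomorphism over a dense open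
`U ⊆ Y`) is obtained by specialization from the generic point of a family — the situation of
`EffectiveResolutionSpread*.lean` — the density of `π⁻¹ U` in `Z` is what does NOT specialize
for free (it would need flatness of the exceptional locus). It is also unnecessary: in a regular
locally Noetherian scheme the closure of an open subset is open
(`Scheme.IsRegular.isOpen_closure`, `EmbeddedResolutionCentre.lean`; the irreducible components
are the connected components), so the open-and-closed piece `Z₀ = closure (π⁻¹ U)` of `Z` is
regular, proper over `Y`, an isomorphism over `U`, and `π⁻¹ U` is dense in it:

* `hasResolution_of_isIso_morphismRestrict` — PROVED: such a `π` yields `Scheme.HasResolution Y`.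

## Sources

* J. Kollár, *Lectures on Resolution of Singularities* (2007), Thm. 3.36 / Def. of resolution
  (weak form as in `ResolutionOfSingularities.lean`). [cite: Kollar2007, Thm. 3.36]
* The Stacks Project, Tag 0357 (components of a normal locally Noetherian scheme are open).
  [folklore]
-/

noncomputable section

universe u

open CategoryTheory CategoryTheory.Limits AlgebraicGeometry TopologicalSpace

namespace Literature.AlgebraicGeometry.Resolution

/-- The restriction of an open immersion over an open subset of its range is an isomorphism.
[folklore] -/
theorem isIso_morphismRestrict_of_le_opensRange {V Z : Scheme.{u}} (f : V ⟶ Z)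
    [IsOpenImmersion f] (W : Z.Opens) (hW : W ≤ f.opensRange) : IsIso (f ∣_ W) := by
  have hsurj : Function.Surjective (f ∣_ W) := by
    intro ⟨z, hz⟩
    obtain ⟨v, rfl⟩ := hW hz
    exact ⟨⟨v, hz⟩, Subtype.ext (by rw [morphismRestrict_base_coe])⟩
  haveI : Epi (f ∣_ W).base := (TopCat.epi_iff_surjective _).mpr hsurj
  exact IsOpenImmersion.isIso (f ∣_ W)

/-- **A proper morphism from a regular locally Noetherian scheme which is an isomorphism over a
dense open yields a resolution of singularities** (in the weak sense `Scheme.HasResolution`):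
restrict it to the open-and-closed subscheme `closure (π⁻¹ U)`, which is regular, proper over
`Y`, isomorphic to `U` over `U`, and in which `π⁻¹ U` is dense. [cite: Kollar2007, Thm. 3.36] -/
theorem hasResolution_of_isIso_morphismRestrict {Z Y : Scheme.{u}} (π : Z ⟶ Y) [IsProper π]
    [IsLocallyNoetherian Z] (hZ : Scheme.IsRegular Z) (U : Y.Opens) (hU : Dense (U : Set Y))
    (hiso : IsIso (π ∣_ U)) : Scheme.HasResolution Y := by
  -- the clopen piece `V = closure (π⁻¹ U)`
  let V : Z.Opens := ⟨closure ((π ⁻¹ᵁ U : Z.Opens) : Set Z), hZ.isOpen_closure (π ⁻¹ᵁ U).isOpen⟩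
  have hle : π ⁻¹ᵁ U ≤ V := fun z hz => subset_closure hz
  haveI : IsClosedImmersion V.ι :=
    IsClosedImmersion.of_isPreimmersion V.ι (by rw [Scheme.Opens.range_ι]; exact isClosed_closure)
  refine ⟨V, V.ι ≫ π, ⟨inferInstance, ?_, hZ.of_isOpenImmersion V.ι⟩⟩
  refine ⟨U, hU, ?_, ?_⟩
  · -- `π⁻¹ U` is dense in its closure
    have hemb := V.ι.isOpenEmbedding
    have hpre : ((V.ι ≫ π) ⁻¹ᵁ U : Set V) = V.ι ⁻¹' ((π ⁻¹ᵁ U : Z.Opens) : Set Z) := rfl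
    rw [dense_iff_closure_eq, hpre, ← hemb.isOpenMap.preimage_closure_eq_closure_preimage
      V.ι.continuous]
    ext v
    simp only [Set.mem_preimage, Set.mem_univ, iff_true]
    exact v.2
  · -- over `U`: `V ⊇ π⁻¹ U`, so `(V.ι ≫ π)|_U = (V.ι|_{π⁻¹U}) ≫ π|_U` is an isomorphism
    rw [morphismRestrict_comp]
    have h1 : IsIso (V.ι ∣_ π ⁻¹ᵁ U) :=
      isIso_morphismRestrict_of_le_opensRange V.ι (π ⁻¹ᵁ U)
        (by rw [Scheme.Opens.opensRange_ι]; exact hle)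
    exact @IsIso.comp_isIso _ _ _ _ _ _ _ h1 hiso

end Literature.AlgebraicGeometry.Resolution

end
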